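import Summits.RiemannHypothesis.RiemannHypothesis.Theorems.WeilCombCombShapePositivityPivotBricks

/-!
# Stubs `stub_screeningProfile` (plan B2b) and `stub_closureConstants` (plan B8) of line `Sketch`

Crux `WeilComb.CombShapePositivity` (item stmt-RiemannHypothesis-11229), line `Sketch`, STUB-PLAN
`stub_windowCore` (Perron-pivot Schur complement), registered stubs `stub_screeningProfile` and
`stub_closureConstants` of the `WeilCombBohrFejer` skeleton.

* `stub_screeningProfile` (B2b, the "screening profile" `s_M(m) = 2H_M − H_{M−m} − H_{M+m} + 3/(2m)` left
  over when the pole row `+Rε H_M √m` of the Perron pivot cancels against its archimedean row): for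
  `1 ≤ m < M`, `0 ≤ 2H_M − H_{M−m} − H_{M+m} + 3/(2m)` and
  `2H_M − H_{M−m} − H_{M+m} ≤ −log(1 − (m/M)²) + 1/(M−m)`.
  Proof: `2H_M − H_{M−m} − H_{M+m} = Σ_{M−m<k≤M} 1/k − Σ_{M<k≤M+m} 1/k`; the first block is `≥ m/M ≥` the
  second (termwise against `1/M`), and against the logarithm `Σ_{M−m<k≤M} 1/k ≤ log M − log(M−m)`,
  `Σ_{M<k≤M+m} 1/k ≥ log(M+m+1) − log(M+1) ≥ log(M+m) − log M − 1/(M−m)`, with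
  `−log(1 − (m/M)²) = 2 log M − log(M−m) − log(M+m)`.
* `stub_closureConstants` (B8, closure arithmetic `c_* ≤ μ̂ κ₀ H_M` with `c_* = 1/16`, `μ̂ = 1/20`,
  `κ₀ = 1/5`): for `M ≥ 400`, `1/16 ≤ (1/20)(1/5) Σ_{m ≤ M} 1/m`, i.e. `H_M ≥ 6.25`, from
  `H_M > log M + γ ≥ log 400 + γ ≥ 5.7 + 0.577`.

Both estimates are already in the tree in curried form, landed by the parallel stub-prover seat in
`Theorems/WeilCombCombShapePositivityPivotBricks.lean` (`WeilCombPivotBricks.screening_profile_bounds`,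
`WeilCombPivotBricks.closure_constants`, p118891); this file records the registered uncurried `∀`-forms
in the skeleton's namespace `WeilCombBohrFejer` and re-proves nothing.
-/

noncomputable section

-- the sub-problem path RiemannHypothesis/RiemannHypothesis duplicates a namespace (D-0017)
set_option linter.dupNamespace false

namespace Summit.RiemannHypothesis.RiemannHypothesis.Theorems.WeilCombBohrFejer

/-- **Stub `stub_screeningProfile` (plan B2b, the screening profile; registered on crux
stmt-RiemannHypothesis-11229).** For naturals `1 ≤ m < M`, with `H` the harmonic numbers,
`0 ≤ 2H_M − H_{M−m} − H_{M+m} + 3/(2m)` and `2H_M − H_{M−m} − H_{M+m} ≤ −log(1 − (m/M)²) + 1/(M−m)`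
(`2H_M − H_{M−m} − H_{M+m} = Σ_{M−m<k≤M} 1/k − Σ_{M<k≤M+m} 1/k`, each block compared with `m/M` and with
the logarithm; `WeilCombPivotBricks.screening_profile_bounds`). [folklore] -/
theorem stub_screeningProfile : ∀ (M m : ℕ), 1 ≤ m → m < M → 0 ≤ 2 * (harmonic M : ℝ) - (harmonic (M - m) : ℝ) - (harmonic (M + m) : ℝ) + 3 / (2 * (m : ℝ)) ∧ 2 * (harmonic M : ℝ) - (harmonic (M - m) : ℝ) - (harmonic (M + m) : ℝ) ≤ -Real.log (1 - ((m : ℝ) / M) ^ 2) + 1 / ((M : ℝ) - m) := by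
  intro M m hm hmM
  exact WeilCombPivotBricks.screening_profile_bounds M m hm hmM

/-- **Stub `stub_closureConstants` (plan B8, closure arithmetic; registered on crux
stmt-RiemannHypothesis-11229).** For every `M ≥ 400`, `1/16 ≤ (1/20)(1/5) Σ_{m=1}^{M} 1/m`, i.e.
`H_M ≥ 6.25 = c_*/(μ̂ κ₀)`: indeed `H_M > log M + γ ≥ log 400 + γ ≥ 5.7 + 0.577`
(`WeilCombPivotBricks.closure_constants`). [folklore] -/
theorem stub_closureConstants : ∀ M : ℕ, 400 ≤ M → (1 : ℝ) / 16 ≤ 1 / 20 * (1 / 5) * ∑ m ∈ Finset.Icc 1 M, (1 : ℝ) / m := by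
  intro M hM
  exact WeilCombPivotBricks.closure_constants M hM

end Summit.RiemannHypothesis.RiemannHypothesis.Theorems.WeilCombBohrFejer

end
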